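import Mathlib
import HarnessLib

/-!
# WeilTypeLadder · the residue lemma behind the existence recipes of THEOREM DP∞

b2b cell `hweil` (packet `run/shared/lean/b2b/hodge-weil/`, report `b2b-hweil-pv3-g49/DP-INFINITY.md` §3.5, prover 3
generation 49). PURE FINITE-FIELD ARITHMETIC in `ZMod p`; no geometry, no named fact, no `decide` census.

The existence recipes for non-split `K`-Weil cyclic-cover Pryms (report 3.6, 3.8, 4.2 (i)–(iv)) have to place prescribed
numbers of rotation letters in prescribed quadratic-residue classes modulo an odd prime `p` with a prescribed sum; the
only input beyond counting is RESIDUE LEMMA 3.5 (a): *for a prime `p ≥ 7` every non-zero `t ∈ 𝔽_p` is a sum of two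
NON-ZERO squares, and also a sum of two NON-squares.* This file proves it from Mathlib's `ZMod.sq_add_sq` (every element
is a sum of two squares) by the `3² + 4² = 5²` trick (a non-zero square `c²` is `(3c/5)² + (4c/5)²` with both summands
non-zero once `p ∤ 3·4·5`):

* `sq_eq_sq_add_sq_of_seven_le` — `c ≠ 0 ⟹ c² = a² + b²` with `a, b ≠ 0` (`p ≥ 7`);
* `exists_sq_add_sq_ne_zero_of_seven_le` — every `t ≠ 0` is `a² + b²` with `a, b ≠ 0` (`p ≥ 7`);
* `exists_nonsquare_add_nonsquare_of_seven_le` — every `t ≠ 0` is `u + v` with `u, v` non-squares (`p ≥ 7`);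
* `not_isSquare_mul_sq` — bookkeeping: `n` a non-square, `a ≠ 0` ⟹ `n·a²` a non-square (any field).

HONEST LABEL: bookkeeping (elementary, folklore); 0 rungs; nothing of Markman 2025 / Mostaed 2026 / Perry 2026 is
used; no kit job.
-/

-- every declaration of this problem lives in `Summit.HodgeConjecture.HodgeConjecture.…` (summit = sub-problem)
set_option linter.dupNamespace false

namespace Summit.HodgeConjecture.HodgeConjecture.WeilTypeLadder

/-- In a field, a non-square times a non-zero square is a non-square. [folklore] -/
theorem not_isSquare_mul_sq {F : Type*} [Field F] {n a : F} (hn : ¬IsSquare n) (ha : a ≠ 0) :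
    ¬IsSquare (n * a ^ 2) := by
  rintro ⟨s, hs⟩
  apply hn
  refine ⟨s / a, ?_⟩
  field_simp
  linear_combination hs

/-- The `3² + 4² = 5²` trick: for a prime `p ≥ 7` every NON-ZERO square `c²` of `ZMod p` is a sum of two NON-ZERO
squares, namely `(3c/5)² + (4c/5)²`. [folklore] -/
theorem sq_eq_sq_add_sq_of_seven_le {p : ℕ} [Fact p.Prime] (hp : 7 ≤ p) {c : ZMod p} (hc : c ≠ 0) :
    ∃ a b : ZMod p, a ≠ 0 ∧ b ≠ 0 ∧ c ^ 2 = a ^ 2 + b ^ 2 := by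
  -- small numerals are non-zero in `ZMod p` for `p ≥ 7` (the existing tree lemma of this shape lives in an unrelated
  -- Literature module; the three instances are discharged inline)
  have hk : ∀ k : ℕ, 0 < k → k < p → (k : ZMod p) ≠ 0 := fun k hk hkp h =>
    absurd (Nat.le_of_dvd hk ((ZMod.natCast_eq_zero_iff k p).mp h)) (not_le.mpr hkp)
  have h3 : (3 : ZMod p) ≠ 0 := by exact_mod_cast hk 3 (by norm_num) (by omega)
  have h4 : (4 : ZMod p) ≠ 0 := by exact_mod_cast hk 4 (by norm_num) (by omega)
  have h5 : (5 : ZMod p) ≠ 0 := by exact_mod_cast hk 5 (by norm_num) (by omega)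
  refine ⟨3 * c / 5, 4 * c / 5, ?_, ?_, ?_⟩
  · exact div_ne_zero (mul_ne_zero h3 hc) h5
  · exact div_ne_zero (mul_ne_zero h4 hc) h5
  · field_simp
    ring

/-- **RESIDUE LEMMA, squares** ([P3-g49] 3.5 (a)): for a prime `p ≥ 7` every non-zero `t ∈ ZMod p` is a sum of two
NON-ZERO squares. [folklore] -/
theorem exists_sq_add_sq_ne_zero_of_seven_le {p : ℕ} [Fact p.Prime] (hp : 7 ≤ p) {t : ZMod p} (ht : t ≠ 0) :
    ∃ a b : ZMod p, a ≠ 0 ∧ b ≠ 0 ∧ t = a ^ 2 + b ^ 2 := by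
  obtain ⟨a, b, hab⟩ := ZMod.sq_add_sq p t
  by_cases ha : a = 0
  · subst ha
    have hb : b ≠ 0 := by rintro rfl; apply ht; rw [← hab]; ring
    obtain ⟨x, y, hx, hy, hxy⟩ := sq_eq_sq_add_sq_of_seven_le hp hb
    exact ⟨x, y, hx, hy, by rw [← hab, ← hxy]; ring⟩
  by_cases hb : b = 0
  · subst hb
    obtain ⟨x, y, hx, hy, hxy⟩ := sq_eq_sq_add_sq_of_seven_le hp ha
    exact ⟨x, y, hx, hy, by rw [← hab, ← hxy]; ring⟩
  exact ⟨a, b, ha, hb, hab.symm⟩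

/-- **RESIDUE LEMMA, non-squares** ([P3-g49] 3.5 (a)): for a prime `p ≥ 7` every non-zero `t ∈ ZMod p` is a sum of two
NON-SQUARES (write `t/n = a² + b²` with `a, b ≠ 0` for a fixed non-square `n`; then `t = n a² + n b²`). [folklore] -/
theorem exists_nonsquare_add_nonsquare_of_seven_le {p : ℕ} [Fact p.Prime] (hp : 7 ≤ p) {t : ZMod p} (ht : t ≠ 0) :
    ∃ u v : ZMod p, ¬IsSquare u ∧ ¬IsSquare v ∧ t = u + v := by
  have hchar : ringChar (ZMod p) ≠ 2 := by
    rw [ZMod.ringChar_zmod_n]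
    omega
  obtain ⟨n, hn⟩ := FiniteField.exists_nonsquare hchar
  have hn0 : n ≠ 0 := by rintro rfl; exact hn ⟨0, by simp⟩
  have htn : t / n ≠ 0 := div_ne_zero ht hn0
  obtain ⟨a, b, ha, hb, hab⟩ := exists_sq_add_sq_ne_zero_of_seven_le hp htn
  refine ⟨n * a ^ 2, n * b ^ 2, not_isSquare_mul_sq hn ha, not_isSquare_mul_sq hn hb, ?_⟩
  have : t = n * (t / n) := by field_simp
  rw [this, hab]
  ring

end Summit.HodgeConjecture.HodgeConjecture.WeilTypeLadder
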